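import Mathlib
import Summits.KontsevichZagierPeriods.KontsevichZagierPeriods.Theses.InverseLandau
import Literature.NumberTheory.Transcendental.KZCalculus
import Literature.NumberTheory.Transcendental.KZLogCalculusProofs
import Literature.NumberTheory.Transcendental.KZProductIdeal
import Literature.NumberTheory.Transcendental.KZDilationMove
import Summits.KontsevichZagierPeriods.KontsevichZagierPeriods.Theorems.BetaCancellation.Negative.Torsion
import Summits.KontsevichZagierPeriods.KontsevichZagierPeriods.Theorems.InverseLandauTateLiftingPullback

/-!
# `TateLifting` (stmt-KontsevichZagierPeriods-9129), line `Sketch` — stub `stub_beanStoneDisc`: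
# the bean-shaped stone is the disc

Stub `stub_beanStoneDisc` of the crux `TateLifting` (kernel form of the Kontsevich–Zagier period
conjecture), verbatim the item `BeanStoneDisc` (stmt-KontsevichZagierPeriods-12252) of route
WeightFloor: the "bean"
`σ = {(x, y) | 4y² ≤ (1 − x²)(2 + x)², −1 ≤ x} = {−1 ≤ x ≤ 1, |y| ≤ (2 + x)√(1 − x²)/2}` with the
integrand `1` (area `∫_{-1}^{1} (2 + x)√(1 − x²) dx = π`) and the closed unit disc
`D̄ = {x² + w² ≤ 1}` with the integrand `1` (area `π`; `KZ.piDisc`) are EQUIVALENT in the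
Kontsevich–Zagier calculus of `KZCalculus.lean`: `[σ, 1] − [D̄, 1] ∈ KZ.relations`
(`tateLifting_beanStoneDisc`).

Proof — two printed moves and one derived rule:
* rule (2) along the shear `Φ(x, w) = (x, w(2 + x)/2)` of `D̄` ONTO `σ` (a polynomial map with
  rational coefficients, injective since `2 + x ≥ 1` on `D̄`, lower-triangular Jacobian
  `(1, 0; w/2, (2 + x)/2)` with `|det Φ'| = (2 + x)/2`; inverse `(x, y) ↦ (x, 2y/(2 + x))`), packaged
  by the honest pull-back engine `tateLifting_pullback`: `[σ, 1] − [D̄, (2 + x)/2 · 1] ∈ relations`;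
* rule (1b) (integrand additivity on `D̄`): `[D̄, (2 + x)/2] − [D̄, 1] − [D̄, x/2] ∈ relations`;
* the odd part `[D̄, x/2]` is a relation (`BeanStoneDisc.of_half_mem`): the point reflection
  `u ↦ −u` of `D̄` onto itself (the dilation move `KZ.smul_sub_mem_relations` with factor `−1`,
  `|det| = 1`) gives `[D̄, x/2] − [D̄, −x/2] ∈ relations`, while `[D̄, x/2] + [D̄, −x/2] ∈ relations`
  (opposite integrands, `KZ.of_add_of_mem_relations_of_eqOn_neg`); hence
  `2 • [D̄, x/2] ∈ relations`, and the formal period group is torsion-free modulo relations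
  (`BetaCancellationNegative.mem_relations_of_nsmul_mem`, Theorems/BetaCancellation/Negative/Torsion).

No definitions are introduced: the shear, its Jacobian and the representation `[D̄, x/2]`
(`BeanStoneDisc.exists_halfXRep`) are written out literally.

References: M. Kontsevich, D. Zagier, *Periods* (2001), §1.1 eq. (1), §1.2 rules (1)–(2);
J. Bochnak, M. Coste, M.-F. Roy, *Real Algebraic Geometry* (1998), §2.2.
-/

noncomputable section

open MeasureTheory Set
open Literature.NumberTheory.Transcendental
open Literature.ModelTheory.ExponentialFields (IsSemialgebraic)
open MvPolynomial (aeval X C)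

namespace Summit.KontsevichZagierPeriods.InverseLandau

namespace BeanStoneDisc

/-! ### The closed unit disc -/

/-- On the closed unit disc the first coordinate is at least `-1`. [folklore] -/
theorem neg_one_le_of_mem_piDisc {z : Fin 2 → ℝ} (hz : z ∈ KZ.piDisc) : -1 ≤ z 0 := by
  rw [KZ.mem_piDisc] at hz
  nlinarith [sq_nonneg (z 1)]

/-- On the closed unit disc `0 < 2 + x`. [folklore] -/
theorem two_add_pos_of_mem_piDisc {z : Fin 2 → ℝ} (hz : z ∈ KZ.piDisc) : 0 < 2 + z 0 := by
  have := neg_one_le_of_mem_piDisc hz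
  linarith

/-- The closed unit disc lies in the square `[-1, 1]²` (as in
`Theorems/TerasomaMultiplicationBetaCancellationStubWeightConst.lean`). [folklore] -/
theorem piDisc_subset_Icc : KZ.piDisc ⊆ Icc (fun _ : Fin 2 => (-1 : ℝ)) (fun _ => 1) := by
  intro z hz
  rw [KZ.mem_piDisc] at hz
  have h0 : z 0 ^ 2 ≤ 1 ^ 2 := by nlinarith [sq_nonneg (z 1)]
  have h1 : z 1 ^ 2 ≤ 1 ^ 2 := by nlinarith [sq_nonneg (z 0)]
  have h0' := abs_le_of_sq_le_sq' h0 zero_le_one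
  have h1' := abs_le_of_sq_le_sq' h1 zero_le_one
  simp only [mem_Icc, Pi.le_def, Fin.forall_fin_two]
  exact ⟨⟨h0'.1, h1'.1⟩, h0'.2, h1'.2⟩

/-- The closed unit disc is compact (a closed subset of the square `[-1, 1]²`). [folklore] -/
theorem isCompact_piDisc : IsCompact KZ.piDisc :=
  isCompact_Icc.of_isClosed_subset (isClosed_le (by fun_prop) continuous_const) piDisc_subset_Icc

/-- The point reflection `u ↦ -u` maps the closed unit disc onto itself. [folklore] -/
theorem image_neg_one_smul_piDisc :
    (fun u : Fin 2 → ℝ => (-1 : ℝ) • u) '' KZ.piDisc = KZ.piDisc := by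
  have hmem : ∀ u ∈ KZ.piDisc, (-1 : ℝ) • u ∈ KZ.piDisc := fun u hu => by
    rw [KZ.mem_piDisc] at hu ⊢
    simpa using hu
  have hinv : ∀ u : Fin 2 → ℝ, (-1 : ℝ) • ((-1 : ℝ) • u) = u := fun u => by simp
  ext u
  constructor
  · rintro ⟨v, hv, rfl⟩
    exact hmem v hv
  · intro hu
    exact ⟨(-1 : ℝ) • u, hmem u hu, hinv u⟩

/-! ### The odd part `[D̄, x/2]` is a relation -/

/-- The representation `[D̄, x/2]` (the odd part of the pulled-back integrand `(2 + x)/2`) exists as an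
honest integral representation: domain the closed unit disc, integrand literally `x/2` (a rational
function, continuous on the compact disc). [cite: KontsevichZagier2001, §1.1 eq. (1)] -/
theorem exists_halfXRep :
    ∃ h : KZ.IntegralRep 2, h.domain = KZ.piDisc ∧ h.integrand = fun z => z 0 / 2 :=
  ⟨⟨KZ.piDisc, fun z => z 0 / 2, KZ.isSemialgebraic_piDisc,
    (isSemialgebraicFunOn_aeval_div_aeval KZ.isSemialgebraic_piDisc (X 0 : MvPolynomial (Fin 2) ℚ) 2
      (fun _ _ => by simp)).congr fun z _ => by simp,
    (Continuous.continuousOn (by fun_prop)).integrableOn_compact isCompact_piDisc⟩, rfl, rfl⟩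

/-- `[D̄, x/2] − [D̄, −x/2] ∈ relations`: ONE change of variables, the point reflection `u ↦ −u` of
the disc onto itself (the dilation move with the rational factor `−1`, `|det| = |−1|² = 1`).
[cite: KontsevichZagier2001, §1.2 rule (2)] -/
theorem of_half_sub_of_neg_mem {h : KZ.IntegralRep 2} (hd : h.domain = KZ.piDisc)
    (hi : h.integrand = fun z => z 0 / 2) : KZ.of h - KZ.of h.neg ∈ KZ.relations := by
  refine KZ.smul_sub_mem_relations (s := (-1 : ℝ)) isAlgebraic_one.neg (by norm_num) h h.neg ?_
    fun x _ => ?_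
  · rw [KZ.IntegralRep.domain_neg, hd, image_neg_one_smul_piDisc]
  · simp [hi, neg_div]

/-- `[h] + [h.neg] ∈ relations` (opposite integrands on the same domain, rule (1)).
[cite: KontsevichZagier2001, §1.2 rule (1)] -/
theorem of_add_of_neg_mem (h : KZ.IntegralRep 2) : KZ.of h + KZ.of h.neg ∈ KZ.relations :=
  KZ.of_add_of_mem_relations_of_eqOn_neg rfl fun _ _ => rfl

/-- **The odd part is a relation**: `[D̄, x/2] ∈ relations`, since
`2 • [D̄, x/2] = ([D̄, x/2] − [D̄, −x/2]) + ([D̄, x/2] + [D̄, −x/2]) ∈ relations` and the formal period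
group is torsion-free modulo relations (`mem_relations_of_nsmul_mem`). [folklore] -/
theorem of_half_mem {h : KZ.IntegralRep 2} (hd : h.domain = KZ.piDisc)
    (hi : h.integrand = fun z => z 0 / 2) : KZ.of h ∈ KZ.relations := by
  refine Summit.KontsevichZagierPeriods.KontsevichZagierPeriods.BetaCancellationNegative.mem_relations_of_nsmul_mem
    (k := 2) two_ne_zero ?_
  have h2 : 2 • KZ.of h = (KZ.of h - KZ.of h.neg) + (KZ.of h + KZ.of h.neg) := by
    abel
  rw [h2]
  exact KZ.relations.add_mem (of_half_sub_of_neg_mem hd hi) (of_add_of_neg_mem h)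

/-! ### The shear `Φ(x, w) = (x, w(2 + x)/2)` of the disc onto the bean -/

/-- The Jacobian `(1, 0; w/2, (2 + x)/2)` of the shear has absolute determinant `(2 + x)/2` on the
closed unit disc (`2 + x > 0` there). [folklore] -/
theorem abs_det_jac {z : Fin 2 → ℝ} (hz : z ∈ KZ.piDisc) :
    |(LinearMap.toContinuousLinearMap
        (Matrix.toLin' !![(1 : ℝ), 0; z 1 / 2, (2 + z 0) / 2])).det| = (2 + z 0) / 2 := by
  rw [LinearMap.det_toContinuousLinearMap, LinearMap.det_toLin', Matrix.det_fin_two_of,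
    one_mul, zero_mul, sub_zero]
  have := two_add_pos_of_mem_piDisc hz
  exact abs_of_pos (by positivity)

/-- The shear is differentiable with derivative the Jacobian `(1, 0; w/2, (2 + x)/2)`
(coordinatewise: `hasFDerivAt_apply`, product rule). [folklore] -/
theorem hasFDerivAt_shear (z : Fin 2 → ℝ) :
    HasFDerivAt (fun y : Fin 2 → ℝ => (![y 0, y 1 * (2 + y 0) / 2] : Fin 2 → ℝ))
      (LinearMap.toContinuousLinearMap
        (Matrix.toLin' !![(1 : ℝ), 0; z 1 / 2, (2 + z 0) / 2])) z := by
  have h0 : HasFDerivAt (fun y : Fin 2 → ℝ => y 0)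
      (ContinuousLinearMap.proj (R := ℝ) (φ := fun _ : Fin 2 => ℝ) 0) z := hasFDerivAt_apply 0 z
  have h1 : HasFDerivAt (fun y : Fin 2 → ℝ => y 1)
      (ContinuousLinearMap.proj (R := ℝ) (φ := fun _ : Fin 2 => ℝ) 1) z := hasFDerivAt_apply 1 z
  rw [hasFDerivAt_pi']
  refine Fin.forall_fin_two.mpr ⟨?_, ?_⟩
  · have hf : (fun y : Fin 2 → ℝ => (![y 0, y 1 * (2 + y 0) / 2] : Fin 2 → ℝ) 0) = fun y => y 0 :=
      funext fun _ => rfl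
    rw [hf]
    refine h0.congr_fderiv (ContinuousLinearMap.ext fun v => ?_)
    simp [Matrix.toLin'_apply, dotProduct, Fin.sum_univ_two]
  · have hf : (fun y : Fin 2 → ℝ => (![y 0, y 1 * (2 + y 0) / 2] : Fin 2 → ℝ) 1) =
        fun y => y 1 * (2 + y 0) * 2⁻¹ :=
      funext fun y => by simp [div_eq_mul_inv]
    rw [hf]
    refine ((h1.mul (h0.const_add 2)).mul_const 2⁻¹).congr_fderiv
      (ContinuousLinearMap.ext fun v => ?_)
    simp [Matrix.toLin'_apply, dotProduct, Fin.sum_univ_two]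
    ring

/-- The shear is injective on the closed unit disc (`2 + x ≠ 0` there). [folklore] -/
theorem injOn_shear :
    InjOn (fun y : Fin 2 → ℝ => (![y 0, y 1 * (2 + y 0) / 2] : Fin 2 → ℝ)) KZ.piDisc := by
  intro x _ y hy hxy
  have h0 : x 0 = y 0 := by
    have := congrFun hxy 0
    simpa using this
  have h1 : x 1 = y 1 := by
    have h := congrFun hxy 1
    simp only [Matrix.cons_val_one, h0] at h
    have hne : (2 + y 0 : ℝ) / 2 ≠ 0 := by
      have := two_add_pos_of_mem_piDisc hy
      positivity
    rw [mul_div_assoc, mul_div_assoc] at h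
    exact mul_right_cancel₀ hne h
  funext i
  fin_cases i
  · exact h0
  · exact h1

/-- The shear maps the closed unit disc INTO the bean: `4(w(2 + x)/2)² = w²(2 + x)² ≤ (1 − x²)(2 + x)²`
and `−1 ≤ x`. [folklore] -/
theorem shear_mem_bean {z : Fin 2 → ℝ} (hz : z ∈ KZ.piDisc) :
    (![z 0, z 1 * (2 + z 0) / 2] : Fin 2 → ℝ) ∈
      {v : Fin 2 → ℝ | 4 * v 1 ^ 2 ≤ (1 - v 0 ^ 2) * (2 + v 0) ^ 2 ∧ -1 ≤ v 0} := by
  have h1 := neg_one_le_of_mem_piDisc hz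
  rw [KZ.mem_piDisc] at hz
  refine ⟨?_, h1⟩
  show 4 * (z 1 * (2 + z 0) / 2) ^ 2 ≤ (1 - z 0 ^ 2) * (2 + z 0) ^ 2
  nlinarith [mul_le_mul_of_nonneg_right (show z 1 ^ 2 ≤ 1 - z 0 ^ 2 by linarith)
    (sq_nonneg (2 + z 0))]

/-- The shear maps the closed unit disc ONTO the bean: the inverse is `(x, y) ↦ (x, 2y/(2 + x))`
(`2 + x ≥ 1` on the bean, and `4y²/(2 + x)² ≤ 1 − x²`). [folklore] -/
theorem image_shear_piDisc :
    (fun y : Fin 2 → ℝ => (![y 0, y 1 * (2 + y 0) / 2] : Fin 2 → ℝ)) '' KZ.piDisc =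
      {v : Fin 2 → ℝ | 4 * v 1 ^ 2 ≤ (1 - v 0 ^ 2) * (2 + v 0) ^ 2 ∧ -1 ≤ v 0} := by
  ext v
  constructor
  · rintro ⟨z, hz, rfl⟩
    exact shear_mem_bean hz
  · rintro ⟨hv, hv1⟩
    have hpos : 0 < 2 + v 0 := by linarith
    have key : (2 * v 1 / (2 + v 0)) ^ 2 ≤ 1 - v 0 ^ 2 := by
      rw [div_pow, div_le_iff₀ (by positivity)]
      nlinarith [hv]
    refine ⟨![v 0, 2 * v 1 / (2 + v 0)], ?_, ?_⟩
    · show v 0 ^ 2 + (2 * v 1 / (2 + v 0)) ^ 2 ≤ 1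
      linarith
    · funext i
      fin_cases i
      · rfl
      · show 2 * v 1 / (2 + v 0) * (2 + v 0) / 2 = v 1
        field_simp

/-- The shear is a `ℚ`-semialgebraic map on the closed unit disc (its coordinates are a coordinate and
a polynomial with rational coefficients). [cite: BCR1998, §2.2] -/
theorem isSemialgebraicMapOn_shear :
    IsSemialgebraicMapOn ℚ KZ.piDisc
      (fun y : Fin 2 → ℝ => (![y 0, y 1 * (2 + y 0) / 2] : Fin 2 → ℝ)) := by
  refine IsSemialgebraicMapOn.of_forall KZ.isSemialgebraic_piDisc (Fin.forall_fin_two.mpr ⟨?_, ?_⟩)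
  · simpa using isSemialgebraicFunOn_aeval KZ.isSemialgebraic_piDisc (X 0 : MvPolynomial (Fin 2) ℚ)
  · exact (isSemialgebraicFunOn_aeval_div_aeval KZ.isSemialgebraic_piDisc
      (X 1 * (2 + X 0) : MvPolynomial (Fin 2) ℚ) 2 (fun _ _ => by simp)).congr fun z _ => by simp

/-- The Jacobian factor `(2 + x)/2` is a `ℚ`-semialgebraic function on the closed unit disc.
[cite: BCR1998, §2.2] -/
theorem isSemialgebraicFunOn_jac :
    IsSemialgebraicFunOn ℚ KZ.piDisc (fun z : Fin 2 → ℝ => (2 + z 0) / 2) :=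
  (isSemialgebraicFunOn_aeval_div_aeval KZ.isSemialgebraic_piDisc
    (2 + X 0 : MvPolynomial (Fin 2) ℚ) 2 (fun _ _ => by simp)).congr fun z _ => by simp

end BeanStoneDisc

open BeanStoneDisc in
/-- **The bean-shaped stone is the disc** (stub `stub_beanStoneDisc` of line `Sketch`; item
`BeanStoneDisc`, stmt-KontsevichZagierPeriods-12252, of route WeightFloor). For any representations
`r = [σ, f]`, `r' = [D̄, f']` with `σ = {4y² ≤ (1 − x²)(2 + x)², −1 ≤ x}` the bean, `D̄ = {x² + w² ≤ 1}`
the closed unit disc and `f = 1` on `σ`, `f' = 1` on `D̄`: `r ∼ r'`. Moves: rule (2) along the shear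
`Φ(x, w) = (x, w(2 + x)/2)` of `D̄` onto `σ` (`|det Φ'| = (2 + x)/2`, `tateLifting_pullback`):
`[σ, f] − [D̄, (2 + x)/2 · f∘Φ] ∈ relations`; rule (1b): `[D̄, (2 + x)/2 · f∘Φ] − [D̄, f'] − [D̄, x/2]`
`∈ relations` (the integrands agree on `D̄`); and the odd part `[D̄, x/2]` is a relation
(`BeanStoneDisc.of_half_mem`: reflection, opposite integrands, torsion-freeness).
[cite: KontsevichZagier2001, §1.2] -/
theorem tateLifting_beanStoneDisc :
    ∀ (r r' : KZ.IntegralRep 2), r.domain = {v : Fin 2 → ℝ | 4 * v 1 ^ 2 ≤ (1 - v 0 ^ 2) * (2 + v 0) ^ 2 ∧ -1 ≤ v 0} → (∀ x ∈ r.domain, r.integrand x = 1) → r'.domain = {v : Fin 2 → ℝ | v 0 ^ 2 + v 1 ^ 2 ≤ 1} → (∀ x ∈ r'.domain, r'.integrand x = 1) → KZ.Equivalent r r' := by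
  intro r r' hr hint hr' hint'
  have hpi : r'.domain = KZ.piDisc := hr'
  -- rule (2): pull `r = [σ, f]` back along the shear of the disc onto the bean
  obtain ⟨r₁, hd₁, hi₁, hrel₁⟩ := tateLifting_pullback 2 r KZ.piDisc
    (fun y : Fin 2 → ℝ => (![y 0, y 1 * (2 + y 0) / 2] : Fin 2 → ℝ))
    (fun z => LinearMap.toContinuousLinearMap
      (Matrix.toLin' !![(1 : ℝ), 0; z 1 / 2, (2 + z 0) / 2]))
    (fun z => (2 + z 0) / 2) KZ.isSemialgebraic_piDisc isSemialgebraicMapOn_shear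
    (fun z _ => (hasFDerivAt_shear z).hasFDerivWithinAt) injOn_shear
    (by rw [hr]; exact image_shear_piDisc) isSemialgebraicFunOn_jac
    (fun z hz => (abs_det_jac hz).symm)
  -- the odd part `[D̄, x/2]`
  obtain ⟨h, hhd, hhi⟩ := exists_halfXRep
  -- rule (1b): `[D̄, (2 + x)/2 · f∘Φ] − [D̄, f'] − [D̄, x/2]` (the integrands agree on `D̄`)
  have hadd : KZ.of r₁ - KZ.of r' - KZ.of h ∈ KZ.relations := by
    refine KZ.integrandAddRel_subset_relations
      ⟨2, r₁, r', h, hpi.trans hd₁.symm, hhd.trans hd₁.symm, fun z hz => ?_, rfl⟩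
    rw [hd₁] at hz
    have hz' : z ∈ r'.domain := by rw [hpi]; exact hz
    have hΦz : (![z 0, z 1 * (2 + z 0) / 2] : Fin 2 → ℝ) ∈ r.domain := by
      rw [hr]; exact shear_mem_bean hz
    rw [hi₁, hhi]
    show (2 + z 0) / 2 * r.integrand ![z 0, z 1 * (2 + z 0) / 2] = r'.integrand z + z 0 / 2
    rw [hint _ hΦz, hint' _ hz']
    ring
  have hsum : KZ.of r - KZ.of r' =
      (KZ.of r - KZ.of r₁) + (KZ.of r₁ - KZ.of r' - KZ.of h) + KZ.of h := by
    abel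
  show KZ.of r - KZ.of r' ∈ KZ.relations
  rw [hsum]
  exact KZ.relations.add_mem (KZ.relations.add_mem hrel₁ hadd) (of_half_mem hhd hhi)

end Summit.KontsevichZagierPeriods.InverseLandau

end
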